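import Mathlib
import Literature.Analysis.FluidPDE.GaussianVortexPlanar
import Literature.Analysis.FluidPDE.GaussianVortexPlanarProofs
import Literature.Analysis.FluidPDE.BiotSavart2DSymmetry
import Literature.Analysis.FluidPDE.PlanarBiotSavartDivFree
import Summits.AnomalousDissipation.AnomalousDissipation.Theorems.MarginalStabilityChainStretchedVortexRowsStubLogPotentialTools
import Summits.AnomalousDissipation.AnomalousDissipation.Theorems.MarginalStabilityChainStretchedVortexRowsStubLogPotentialSymmetry
import Summits.AnomalousDissipation.AnomalousDissipation.Theorems.MarginalStabilityChainStretchedVortexRowsStubLogPotentialEnergy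
import HarnessLib

/-!
# Helper `logPotential_neutral_energy` toward stub `stub_coreInverse` of the line `braid-closed-large-circulation-gluing`
# (crux stmt-AnomalousDissipation-3009, `MarginalStabilityChain.StretchedVortexRows`)

Wave 3, the key analytic input of the ROTATION COERCIVITY in the lead's energy method: for a `C¹` density `g` of
Gaussian class on `ℝ² = EuclideanSpace ℝ (Fin 2)` which is NEUTRAL (`∫ g = 0`), even, and has zero circular means,
the logarithmic potential `ψ = N ∗ g`, `N = (2π)⁻¹ log ‖·‖`, is `C¹`, even, has zero circular means, `∇ψ ∈ L²`,
`ψ g ∈ L¹`, and `∫ ‖∇ψ‖² = −∫ ψ g`. Assembly of the registered helpers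

* `logPotential_contDiff_one` (…`StubLogPotentialTools`): `ψ ∈ C¹`, derivative on the density, log-kernel toolkit,
  reduction of the Gaussian class `|g| + ‖Dg‖ ≤ A(1+‖η‖)^k G` to `|g|, ‖Dg‖ ≤ B e^{−‖η‖²/8}`;
* `logPotential_gradient_eq` (…`Gradient`): `∇ψ = ∫ g(η) DN(· − η) dη` by one singular integration by parts;
* `logPotential_weak_poisson` (…`Green`): `∫ ⟪∇ψ, ∇φ⟫ = −∫ g φ` for `φ ∈ C¹_c` (Green's identity in gradient form
  by polar coordinates, Fubini);
* `logPotential_gradient_decay` (…`Decay`): NEUTRALITY ⇒ `‖∇ψ‖ ≤ C/(1+‖ξ‖)²`;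
* `logPotential_even_circMean` (…`Symmetry`): evenness and zero circular means pass from `g` to `ψ`;
* `logPotential_energy_identity` (…`Energy`): `‖∇ψ‖² ∈ L¹`, `ψ g ∈ L¹`, `∫ ‖∇ψ‖² = −∫ ψ g` (cut-off argument).
-/

set_option linter.dupNamespace false

noncomputable section

open scoped RealInnerProductSpace Topology ContDiff
open MeasureTheory WithLp Function Metric Filter Set

namespace Summit.AnomalousDissipation.AnomalousDissipation.Theorems.MarginalStabilityChainStretchedVortexRows

open Literature.Analysis.FluidPDE

/-- W3-E (logarithmic potential of a NEUTRAL, even, circular-mean-free Gaussian-class density): `ψ = N ∗ g` is `C¹`,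
even, has zero circular means, `∇ψ ∈ L²`, and the energy identity `∫ |∇ψ|² = −∫ ψ g` holds. -/
theorem logPotential_neutral_energy :
    ∀ (k : ℕ) (A : ℝ) (g : EuclideanSpace ℝ (Fin 2) → ℝ), ContDiff ℝ 1 g →
      (∀ η, |g η| + ‖fderiv ℝ g η‖ ≤ A * (1 + ‖η‖) ^ k * gaussVortexProfile η) →
      (∫ η, g η = 0) → (∀ η, g (-η) = g η) →
      (∀ r, 0 < r → ∫ θ in (0:ℝ)..(2 * Real.pi), g (toLp 2 ![r * Real.cos θ, r * Real.sin θ]) = 0) →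
      let ψ : EuclideanSpace ℝ (Fin 2) → ℝ := fun ξ => ∫ η, (2 * Real.pi)⁻¹ * Real.log ‖ξ - η‖ * g η
      ContDiff ℝ 1 ψ ∧ (∀ ξ, ψ (-ξ) = ψ ξ) ∧
        (∀ r, 0 < r → ∫ θ in (0:ℝ)..(2 * Real.pi), ψ (toLp 2 ![r * Real.cos θ, r * Real.sin θ]) = 0) ∧
        Integrable (fun ξ => ‖gradient ψ ξ‖ ^ 2) ∧ Integrable (fun ξ => ψ ξ * g ξ) ∧
        ∫ ξ, ‖gradient ψ ξ‖ ^ 2 = -∫ ξ, ψ ξ * g ξ := by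
  intro k A g hg hbound hneutral heven hcirc ψ
  obtain ⟨B, -, hg0, hg1⟩ := gaussClass_reduce hbound
  have hψ : ψ = fun ξ : EuclideanSpace ℝ (Fin 2) => ∫ η, (2 * Real.pi)⁻¹ * Real.log ‖ξ - η‖ * g η := rfl
  obtain ⟨hI1, hI2, hE⟩ := logPotential_energy_identity B g hg hg0 hg1 hneutral ψ hψ
  obtain ⟨hevenψ, hcircψ⟩ := logPotential_even_circMean B g hg.continuous hg0 heven hcirc
  refine ⟨?_, fun ξ => hevenψ ξ, fun r hr => hcircψ r hr, hI1, hI2, hE⟩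
  rw [hψ]
  exact (logPotential_contDiff_one B g hg hg0 hg1).1

end Summit.AnomalousDissipation.AnomalousDissipation.Theorems.MarginalStabilityChainStretchedVortexRows

end
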